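import Summits.BirchSwinnertonDyer.Rank1Residual.O5.HeegnerLogTransportThreeOrdSelmer
import HarnessLib
import HarnessLib.Audit.Tags

/-!
# Heegner-log transport at `p = 3` (KL3), part 5 (continued): the END assembly `o5_index_unit_of_good_companion_selmer`
# and its row-C16 form — o5-r2 GEN 18

HONEST FRAMING (cell `b2b-bsdres`, run/shared/lean/b2b/bsd-rank1-residual/, verbatim in every file): the
goal of the cell is to DELETE the COMBINATION-SHAPED residual classes of the Birch–Swinnerton-Dyer formula
for ALL analytic-rank `≤ 1` elliptic curves over `ℚ` — "full BSD formula for every rank `≤ 1` curve in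
class `C`" assembled STRICTLY from published theorems — so that the rank-`≤ 1` remainder becomes exactly
the CONSTRUCTION-SHAPED classes, which are TYPED (missing-input `Prop`s), NOT attempted. This is not
"finishing BSD". Team O5 (tame potentially supersingular additive `p = 3`, (t′)), planner o5-r2 (the
non-Iwasawa side), GEN 18; RESEARCH ROUTE; THEOREMS ONLY (bookkeeping over explicit hypotheses); no named
fact, no definition, no conjecture node; NOTHING is booked and no mark of `RESIDUAL-MAP.md` moves. O5 OPEN.

This is §3 of o5-r2 GEN 18's source `HOME/b2b-bsdres-o5-r2/gen18/lean/HeegnerLogTransportThreeOrdSelmer.lean`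
(split for `lint.size`); §0–§2 (the node KL3-G `GoodBaseSelmerCountThree`, L1′, integrality, the consumed
direction) are the sibling `O5/HeegnerLogTransportThreeOrdSelmer.lean`, whose module text describes the whole.
Chain of the END theorem: L1′ ⇒ KL3-B (`Sel_𝔭(K, W[3^∞]) = 0`) ⇒ KL3-M (`Sel_𝔭(K, G[3^∞]) = 0`) ⇒ KL3-G read
backwards (`Ш(G/K)[3^∞] = 0`, log/index identity for `P′`) ⇒ BSD₃ of the pair (`3 ∤ [G(K):ℤP′]`, GEN 17 §2) ⇒
companion Heegner log a `3`-adic unit ⇒ KL3-A (GEN 16 W-side chain) ⇒ `3 ∤ [W(K):ℤP]`.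
References: as in the sibling; [JetchevSkinnerWan2017] Prop. 3.2.1, (7.1.5); [KrizLi2019] Thm. 1.16;
[YanZhu2024MainConjNonCM] Thm. 4.15; [GrossLMS1991] Conj. 1.2; HOME/b2b-bsdres-o5-r2/gen18/O5-GEN18.md.

## TYPER PLACEMENT NOTE (cc-typer-5 GEN 18 = O5 §3.5 / O6 §3.4 typer of record; by-name ask A-O5-G18-1 of o5-r2 GEN 18, HOME/INBOX.md l.13673:
'place by sha, the same way as A-O5-G17-1 … as TWO tree files for lint.size, pre-split by me')

Source: `HOME/b2b-bsdres-o5-r2/gen18/lean/HeegnerLogTransportThreeOrdSelmer.lean` sha16 `94876e55775e7a08` (468 l.; `gen18/SHA16.txt`; o5-r2's `lean check` rc 0 / 0 sorries /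
0 warnings 23:42Z) PRE-SPLIT by the planner into part A `gen18/lean/split/O5_HeegnerLogTransportThreeOrdSelmer.partA.lean` `5e6912d1af4b7cb4` (316 l. = source l.1–313
+ `end`s) and part B `gen18/lean/split/O5_HeegnerLogTransportThreeOrdSelmerIndex.partB.lean` `f039c95cc56d82ab` (202 l. = source §3 l.314–468 under its own header);
THIS file = part B VERBATIM + this paragraph (the typer re-hashed all three files and asserted part A == source prefix, part B §3.. == source §3..
byte for byte, script `class-closure/typer-5/gen18/g18_place.py`; farm: part A standalone and A+B joint rc 0 / 0 warnings, axioms of the END theorems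
{propext, Classical.choice, Quot.sound}; DEDUP `lean search --decl` on the nine new names: no match).  CONTENT LABELS (source, unchanged): ONE new node
`GoodBaseSelmerCountThree` = KL3-G (Jetchev–Skinner–Wan 2017 Prop. 3.2.1 with (7.1.5), IN PRINT; typed as a plain `def … : Prop` THEOREM-CANDIDATE consumed
only as the hypothesis `hG`, exactly like KL3-A / KL3-B / KL3-M of `O5/HeegnerLogTransportThree.lean` p340741 — NOT a Literature fact, NOT `@[conjecture]`;
the advisory audit classes it `vendored-fact (untagged def : Prop)` as it does KL3-A/B/M) + 8 THEOREMS PROVED; 0 `@[conjecture]`; 0 Literature facts (net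
named-fact debt 0); no `sorry`.  Parts 1–4 of the KL3 files: `O5/HeegnerLogTransportThree{,Chain,Targets,Global}.lean` (p340741 / p341262 / p341640 / p342632),
`O5/HeegnerLogTransportThreeOrdCompanion{,Index}.lean` (p343587 / p344465), `Literature/NumberTheory/EllipticCurves/HeegnerPointFiniteIndex.lean` (p344022).
HONEST FRAMING (cell `b2b-bsdres`): research route, lane CLASS-CLOSURE §3.5 O5; nothing asserted beyond the displayed binders, nothing booked, no mark of
`RESIDUAL-MAP.md` moves; census = EVIDENCE, never a Literature fact; O5 OPEN.
-/

noncomputable section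

open scoped Classical

open WeierstrassCurve Literature.NumberTheory.EllipticCurves
  Literature.NumberTheory.EllipticCurves.ModularForms
  Literature.NumberTheory.EllipticCurves.Rank1Residual
  Literature.NumberTheory.EllipticCurves.Rank1Residual.Typed

namespace Summit.BirchSwinnertonDyer.Rank1Residual.O5.HeegnerLogTransport

open Summit.BirchSwinnertonDyer.Rank1Residual.X11b (padicLogOrd embAt padicPointOf index_zmultiples_zsmul)
open Summit.BirchSwinnertonDyer.Rank1Residual.X11b.LocalIndex (psi
  exists_addEquiv_valuation_psi_padicPointOf valuation_psi_zsmul_add)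
open Literature.NumberTheory.EllipticCurves.Rank1Residual (Addv)
open Summit.BirchSwinnertonDyer.Rank1Residual.Additive.LocalLog (reductionPointCount_of_addv)
open Summit.BirchSwinnertonDyer.Rank1Residual.X11b.AcSelmer (selmerAcBase)
open IsDedekindDomain (HeightOneSpectrum)
open scoped NumberField

/-! ## §3 END: KL3-C♭ on good companions with BSD₃ — class-level inputs only -/

/-- **KL3-C♭ (read at `ι₃ = embAt 𝔭`) on a companion GOOD at `3` whose Heegner pair satisfies BSD₃, modulo
KL3-A/B/M/G.** `W` (t′) at `3` (`Addv`, `v₃(j) ≥ 0`, `f₃ = 2`) with `ρ̄_{W,3}` onto, `a₃(W) = 0`, `W(ℚ₃)[3] = 0`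
and `W(ℚ_ℓ)[3] = 0` at the primes `ℓ ≠ 3` of `N_W N_G`, Tamagawa and Manin `3`-units, depletion units off `3`;
`G` globally minimal GOOD at `3`, congruent to `W` mod `3` off `3 N_W N_G`, with a `ℚ`-model `Gd` of `G^{(d_K)}`,
both `Ш` finite and BSD₃ in Miller's currency for both (`MissingPPartAt`), `3 ∤ ∏ c_q(G)`; a common Heegner
field `K` (`d_K < −4`, `3 ∤ d_K`, Heegner for `N`, `N′` and `N_W N_G`), Kolyvagin for both curves over `K`, a
degree-one prime `𝔭 ∣ 3`, Heegner points `P, P′` of infinite order, `Ш(W/K)[3^∞] = 0`, ONE point `Q ∈ W(K)` of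
infinite order with `ord₃ log_{ω_W} Q = 0` at `embAt 𝔭`, and the STEP-0 identity of the pair (Gross–Zagier in
the census currency). THEN `3 ∤ [W(K) : ℤP]`. Every published / candidate input is an explicit binder
(`hA` KL3-A, `hB` KL3-B, `hM` KL3-M, `hG` KL3-G). [cite: KrizLi2019, Thm. 1.16, Rem. 1.17]
[cite: JetchevSkinnerWan2017, Prop. 3.2.1 and (7.1.5)] [cite: GrossLMS1991, §1 Conj. 1.2 (p. 237)] -/
theorem o5_index_unit_of_good_companion_selmer
    (hA : KrizLiUnitBitTransportThree) (hB : O5BaseSelmerCountThree)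
    (hM : ResidualSelmerMatchingThree) (hG : GoodBaseSelmerCountThree)
    (W G : WeierstrassCurve ℚ) [W.IsElliptic] [W.IsGloballyMinimal] [G.IsElliptic] [G.IsGloballyMinimal]
    (hcong : ∀ ℓ : ℕ, ℓ.Prime → ¬ (ℓ ∣ 3 * W.conductorNorm ℤ * G.conductorNorm ℤ) →
      ((W.LFunction ℓ : ℤ) : ZMod 3) = ((G.LFunction ℓ : ℤ) : ZMod 3))
    (hρ : W.HasSurjectiveModNGaloisRep 3) (hadd : Addv W 3) (hj : 0 ≤ padicValRat 3 W.j)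
    (hf₂ : Additive.CondExpTwo W 3) (hWa3 : W.LFunction 3 = 0) (ht3 : NoLocalThreeTorsionAt W 3)
    (htℓ : ∀ (ℓ : ℕ) [Fact ℓ.Prime], ℓ ≠ 3 → (ℓ : ℤ) ∣ W.conductorNorm ℤ * G.conductorNorm ℤ →
      NoLocalThreeTorsionAt W ℓ)
    (hNW : W.conductorNorm ℤ ≠ 0) (hNG : G.conductorNorm ℤ ≠ 0)
    (hunitW : ∀ ℓ ∈ klSet W G, ℓ ≠ 3 → padicValInt 3 (nsCount W ℓ) = 0)
    (hunitG : ∀ ℓ ∈ klSet G W, ℓ ≠ 3 → padicValInt 3 (nsCount G ℓ) = 0)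
    (htam : ¬ 3 ∣ W.tamagawaProduct) (htamG : ¬ 3 ∣ G.tamagawaProduct)
    (hgoodG : G.HasGoodReductionAtPrime 3)
    (Gd : WeierstrassCurve ℚ) [Gd.IsElliptic] (hfinG : Finite G.sha) (hfinGd : Finite Gd.sha)
    (hMG : MissingPPartAt G 3) (hMGd : MissingPPartAt Gd 3)
    {N N' : ℕ} [NeZero N] [NeZero N'] (D : ModularParametrizationData W N)
    (D' : ModularParametrizationData G N')
    (K : Type) [Field K] [NumberField K] (hK : IsImaginaryQuadratic K)
    (hH : SatisfiesHeegnerHypothesis N K) (hH' : SatisfiesHeegnerHypothesis N' K)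
    (hHWG : SatisfiesHeegnerHypothesis (W.conductorNorm ℤ * G.conductorNorm ℤ) K)
    (hKoW : kolyvagin N W K) (hKoG : kolyvagin N' G K)
    (hd : NumberField.discr K < -4) (h3d : ¬ ((3 : ℤ) ∣ NumberField.discr K))
    (hGd : ∃ C : VariableChange ℚ, C • G.quadraticTwist (NumberField.discr K : ℚ) = Gd)
    (H : HeegnerDatum N (NumberField.discr K)) (H' : HeegnerDatum N' (NumberField.discr K))
    (ι : K →+* ℂ) (𝔭 : HeightOneSpectrum (𝓞 K)) (h𝔭 : ((3 : ℕ) : 𝓞 K) ∈ 𝔭.asIdeal)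
    (he : 𝔭.asIdeal.ramificationIdx (𝓞 ℚ) = 1) (hf : 𝔭.asIdeal.inertiaDeg (𝓞 ℚ) = 1)
    (P : (W.baseChange K).toAffine.Point) (P' : (G.baseChange K).toAffine.Point)
    (hP : WeierstrassCurve.Affine.Point.map ι.toRatAlgHom P = heegnerPointComplex D H)
    (hP' : WeierstrassCurve.Affine.Point.map ι.toRatAlgHom P' = heegnerPointComplex D' H')
    (hPinf : ¬ IsOfFinAddOrder P) (hP'inf : ¬ IsOfFinAddOrder P')
    (hshaW : Nat.card (AddCommGroup.primaryComponent (W.baseChange K).sha 3) = 1)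
    (hQW : ∃ Q : (W.baseChange K).toAffine.Point, ¬ IsOfFinAddOrder Q ∧
      padicLogOrd W 3 (embAt K 3 𝔭 h𝔭 he hf) Q = 0)
    (hcD : padicValInt 3 D.maninConstant = 0) (hcD' : padicValInt 3 D'.maninConstant = 0)
    {q₀ q₁ : ℚ} (hq₀ : shaAn G = (q₀ : ℂ)) (hq₁ : shaAn Gd = (q₁ : ℂ))
    (hstep0 : padicValRat 3 q₀ + padicValRat 3 q₁ + ((2 * padicValNat 3 G.tamagawaProduct : ℕ) : ℤ) +
        ((2 * padicValInt 3 D'.maninConstant : ℕ) : ℤ) =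
      ((2 * padicValNat 3 (AddSubgroup.zmultiples P').index : ℕ) : ℤ)) :
    padicValNat 3 (AddSubgroup.zmultiples P).index = 0 := by
  haveI : Finite G.sha := hfinG
  haveI : Finite Gd.sha := hfinGd
  -- W side: `W(K)[3] = 0`, `3 ∤ c₃(W)`, finite index, and L1′
  have htorsW := nsmul_eq_zero_imp_eq_zero_of_surj W K hK (by norm_num) hρ
  have hc3 := not_dvd_localTamagawaNumber_of_not_dvd_tamagawaProduct W htam
  have hI0W : (AddSubgroup.zmultiples P).index ≠ 0 :=
    index_zmultiples_ne_zero_of_isHeegnerPoint N W K hKoW hK hH ⟨D, H, ι, hP⟩ hPinf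
  obtain ⟨Q, hQinf, hQunit⟩ := hQW
  have hlog := padicLogOrd_eq_padicValNat_index_of_logUnit W hadd hc3 htorsW (embAt K 3 𝔭 h𝔭 he hf) P Q
    hPinf hQinf hI0W hQunit
  -- KL3-B: `Sel_𝔭(K, W[3^∞]) = 0`; KL3-M: `Sel_𝔭(K, G[3^∞]) = 0`
  have hSelW := selmerAcBase_card_eq_one_of_units hB W hadd hj hf₂ hρ ht3 D K hK hH hd H ι P hP hPinf
    𝔭 h𝔭 he hf hshaW hlog
  have hSelG : Nat.card (selmerAcBase (G.baseChange K) 3 𝔭 ∅) = 1 :=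
    (hM W G hρ hcong ht3 htℓ K hK hHWG 𝔭 h𝔭).mp hSelW
  -- companion-side hypotheses transported along `ρ̄_{G,3} ≅ ρ̄_{W,3}`
  have hirrW : W.HasIrreducibleModPGaloisRep 3 :=
    hasIrreducibleModPGaloisRep_of_hasSurjectiveModNGaloisRep W 3 hρ
  have ht3G : NoLocalThreeTorsionAt G 3 := noLocalThreeTorsionAt_of_isCongruentModThree W G hirrW hcong 3 ht3
  have htorsG := nsmul_eq_zero_imp_eq_zero_of_isCongruentModThree W G hirrW hcong K htorsW
  haveI : (G.baseChange K).IsElliptic := by rw [WeierstrassCurve.baseChange]; infer_instance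
  have hKol := hKoG hK hH' ⟨D', H', ι, hP'⟩ hP'inf
  have hI0G : (AddSubgroup.zmultiples P').index ≠ 0 :=
    index_zmultiples_ne_zero_of_isHeegnerPoint N' G K hKoG hK hH' ⟨D', H', ι, hP'⟩ hP'inf
  -- KL3-G read backwards: `Ш(G/K)[3^∞] = 0` and the KL-normalised log of `P′` has the valuation of the index
  obtain ⟨hshaG, hklG⟩ := sha_trivial_and_klLog_eq_of_selmer_trivial hG G hgoodG ht3G K hK htorsG hKol.1
    hKol.2 P' hP'inf hI0G 𝔭 h𝔭 he hf hSelG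
  -- BSD₃ of the pair `(G, G^{(d_K)})`: `3 ∤ [G(K) : ℤP′]`, so the companion Heegner log is a `3`-adic unit
  obtain ⟨hu₀, hu₁⟩ := padicValRat_shaAn_pair_eq_zero_of_sha_trivial G Gd K hK hGd 3 (by decide) hMG hMGd
    hq₀ hq₁ hshaG
  obtain ⟨hI, -⟩ := padicValNat_index_eq_zero_of_missingPPartAt_pair G Gd K hK hGd 3 (by decide) hMG hMGd
    P' hq₀ hq₁ hstep0 hu₀ hu₁ (padicValNat.eq_zero_of_not_dvd htamG) hcD'
  have hGunit : padicLogOrd G 3 (embAt K 3 𝔭 h𝔭 he hf) P' + padicValInt 3 (nsCount G 3) - 1 = 0 := by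
    rw [hklG, hI, Nat.cast_zero]
  -- KL3-A: the W-side chain of GEN 16
  exact padicValNat_index_eq_zero_of_companion_unit' hA W G hcong hρ hadd hWa3 hNW hNG hunitW hunitG htam
    D D' K hK hH hH' hd h3d H H' ι (embAt K 3 𝔭 h𝔭 he hf) P P' hP hP' hPinf hP'inf hcD hcD' hGunit

/-- **Row C16 plugged in**: the same with BSD₃ of the companion pair supplied by Yan–Zhu 2026 Thm. 4.15
(`hYZ`, NAMED FACT `YanZhu2026.thm415_padicValRat_bsd_rank_le_one`, flag `YZ26@3-BF-ERL-Ohta`) through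
`Partition.RowC16.bsdp` (good ORDINARY `3`, `ρ̄` irreducible, surj(3) ∨ ram; Wuthrich Lemma 20 `hW20`,
modularity `hmod`, Gross–Zagier–Kolyvagin `hGZK`, both analytic ranks `≤ 1`). So on the 274/870 C-KL3-V pairs
with good-ordinary row-C16 companions, KL3-C♭ at `embAt 𝔭` is a theorem modulo KL3-A (print), KL3-B, KL3-M,
KL3-G (print) and the named facts — no per-pair numerics, no open conjecture. [cite: YanZhu2024MainConjNonCM, Thm. 4.15 (§4.6)]
[cite: KrizLi2019, Thm. 1.16] [cite: JetchevSkinnerWan2017, Prop. 3.2.1 and (7.1.5)] -/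
theorem o5_index_unit_of_goodOrd_companion_selmer
    (hA : KrizLiUnitBitTransportThree) (hB : O5BaseSelmerCountThree)
    (hM : ResidualSelmerMatchingThree) (hG : GoodBaseSelmerCountThree)
    (hYZ : YanZhu2026.thm415_padicValRat_bsd_rank_le_one)
    (hW20 : Wuthrich2014.lemma20_surjective_threeAdic_of_semistable)
    (hmod : hasEntireLFunction_rat) (hGZK : rank_eq_analyticRank_of_analyticRank_le_one)
    (W G : WeierstrassCurve ℚ) [W.IsElliptic] [W.IsGloballyMinimal] [G.IsElliptic] [G.IsGloballyMinimal]
    (hcong : ∀ ℓ : ℕ, ℓ.Prime → ¬ (ℓ ∣ 3 * W.conductorNorm ℤ * G.conductorNorm ℤ) →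
      ((W.LFunction ℓ : ℤ) : ZMod 3) = ((G.LFunction ℓ : ℤ) : ZMod 3))
    (hρ : W.HasSurjectiveModNGaloisRep 3) (hadd : Addv W 3) (hj : 0 ≤ padicValRat 3 W.j)
    (hf₂ : Additive.CondExpTwo W 3) (hWa3 : W.LFunction 3 = 0) (ht3 : NoLocalThreeTorsionAt W 3)
    (htℓ : ∀ (ℓ : ℕ) [Fact ℓ.Prime], ℓ ≠ 3 → (ℓ : ℤ) ∣ W.conductorNorm ℤ * G.conductorNorm ℤ →
      NoLocalThreeTorsionAt W ℓ)
    (hNW : W.conductorNorm ℤ ≠ 0) (hNG : G.conductorNorm ℤ ≠ 0)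
    (hunitW : ∀ ℓ ∈ klSet W G, ℓ ≠ 3 → padicValInt 3 (nsCount W ℓ) = 0)
    (hunitG : ∀ ℓ ∈ klSet G W, ℓ ≠ 3 → padicValInt 3 (nsCount G ℓ) = 0)
    (htam : ¬ 3 ∣ W.tamagawaProduct) (htamG : ¬ 3 ∣ G.tamagawaProduct)
    (hrG : G.analyticRank ≤ 1) (hC16 : RowC16 G 3)
    (Gd : WeierstrassCurve ℚ) [Gd.IsElliptic] [Gd.IsGloballyMinimal] (hrGd : Gd.analyticRank ≤ 1)
    (hC16d : RowC16 Gd 3)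
    {N N' : ℕ} [NeZero N] [NeZero N'] (D : ModularParametrizationData W N)
    (D' : ModularParametrizationData G N')
    (K : Type) [Field K] [NumberField K] (hK : IsImaginaryQuadratic K)
    (hH : SatisfiesHeegnerHypothesis N K) (hH' : SatisfiesHeegnerHypothesis N' K)
    (hHWG : SatisfiesHeegnerHypothesis (W.conductorNorm ℤ * G.conductorNorm ℤ) K)
    (hKoW : kolyvagin N W K) (hKoG : kolyvagin N' G K)
    (hd : NumberField.discr K < -4) (h3d : ¬ ((3 : ℤ) ∣ NumberField.discr K))
    (hGd : ∃ C : VariableChange ℚ, C • G.quadraticTwist (NumberField.discr K : ℚ) = Gd)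
    (H : HeegnerDatum N (NumberField.discr K)) (H' : HeegnerDatum N' (NumberField.discr K))
    (ι : K →+* ℂ) (𝔭 : HeightOneSpectrum (𝓞 K)) (h𝔭 : ((3 : ℕ) : 𝓞 K) ∈ 𝔭.asIdeal)
    (he : 𝔭.asIdeal.ramificationIdx (𝓞 ℚ) = 1) (hf : 𝔭.asIdeal.inertiaDeg (𝓞 ℚ) = 1)
    (P : (W.baseChange K).toAffine.Point) (P' : (G.baseChange K).toAffine.Point)
    (hP : WeierstrassCurve.Affine.Point.map ι.toRatAlgHom P = heegnerPointComplex D H)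
    (hP' : WeierstrassCurve.Affine.Point.map ι.toRatAlgHom P' = heegnerPointComplex D' H')
    (hPinf : ¬ IsOfFinAddOrder P) (hP'inf : ¬ IsOfFinAddOrder P')
    (hshaW : Nat.card (AddCommGroup.primaryComponent (W.baseChange K).sha 3) = 1)
    (hQW : ∃ Q : (W.baseChange K).toAffine.Point, ¬ IsOfFinAddOrder Q ∧
      padicLogOrd W 3 (embAt K 3 𝔭 h𝔭 he hf) Q = 0)
    (hcD : padicValInt 3 D.maninConstant = 0) (hcD' : padicValInt 3 D'.maninConstant = 0)
    {q₀ q₁ : ℚ} (hq₀ : shaAn G = (q₀ : ℂ)) (hq₁ : shaAn Gd = (q₁ : ℂ))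
    (hstep0 : padicValRat 3 q₀ + padicValRat 3 q₁ + ((2 * padicValNat 3 G.tamagawaProduct : ℕ) : ℤ) +
        ((2 * padicValInt 3 D'.maninConstant : ℕ) : ℤ) =
      ((2 * padicValNat 3 (AddSubgroup.zmultiples P').index : ℕ) : ℤ)) :
    padicValNat 3 (AddSubgroup.zmultiples P).index = 0 := by
  haveI : Finite G.sha := (hGZK G hrG).2
  haveI : Finite Gd.sha := (hGZK Gd hrGd).2
  have hMG : MissingPPartAt G 3 := missingPPartAt_of_bsdp G 3 (RowC16.bsdp hYZ hW20 hmod hGZK hrG hC16)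
  have hMGd : MissingPPartAt Gd 3 :=
    missingPPartAt_of_bsdp Gd 3 (RowC16.bsdp hYZ hW20 hmod hGZK hrGd hC16d)
  exact o5_index_unit_of_good_companion_selmer hA hB hM hG W G hcong hρ hadd hj hf₂ hWa3 ht3 htℓ hNW hNG
    hunitW hunitG htam htamG hC16.2.1.1 Gd ‹Finite G.sha› ‹Finite Gd.sha› hMG hMGd D D' K hK hH hH' hHWG
    hKoW hKoG hd h3d hGd H H' ι 𝔭 h𝔭 he hf P P' hP hP' hPinf hP'inf hshaW hQW hcD hcD' hq₀ hq₁ hstep0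

end Summit.BirchSwinnertonDyer.Rank1Residual.O5.HeegnerLogTransport

end
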